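import Literature.AlgebraicGeometry.Motives.MumfordTateInvariantsLieStabilizer
import HarnessLib

/-!
# Descent `ℂ → ℚ` for annihilators and commutants: "the Hodge group is defined over `ℚ`" (Zarhin's theorem, step 3)

For a finite-dimensional `ℚ`-vector space `V` with complexification `V_ℂ = ℂ ⊗ V`, the
comparison `κ : c ⊗ X ↦ c • X_ℂ` identifies `ℂ ⊗_ℚ End_ℚ(V)` with `End_ℂ(V_ℂ)`
(`homBaseChange`, bijective by `homBaseChange_bijective`). We prove the two DESCENT statements
used in the tree's proof of Zarhin's theorem (Huybrechts, *Lectures on K3 Surfaces*, Thm. 3.3.9)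
to replace "the Hodge group `Hdg ≤ GL(V)` is an algebraic group defined over `ℚ`, hence so are
its Lie algebra and its commutant" (Deligne, LNM 900, I §3; Zarhin 1983, §2):

* `mem_span_baseChange_of_forall_tensorDerivation_eq_zero`: a `ℂ`-linear endomorphism `Y` of
  `V_ℂ` whose derivation action kills the complexifications `ι t` of a family of RATIONAL tensors
  `t` lies in the `ℂ`-span of the complexifications `X_ℂ` of the RATIONAL endomorphisms `X` whose
  derivation action kills the `t` themselves — the complex annihilator is spanned by the rational
  annihilator ("`Lie(Hdg)_ℂ = Lie(Hdg) ⊗ ℂ`");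
* `mem_span_baseChange_of_forall_commute`: a `ℂ`-linear endomorphism of `V_ℂ` commuting with the
  complexifications of a family of rational endomorphisms lies in the `ℂ`-span of the
  complexifications of the rational endomorphisms commuting with the family.

Both are instances of the general principle `mem_baseChange_iInf_ker` of
`MumfordTateInvariantsLieStabilizer.lean` (for an ARBITRARY family of `ℚ`-linear maps
`Lᵢ : M → Nᵢ`, an element of `ℂ ⊗ M` killed by every `(Lᵢ)_ℂ` lies in `(⋂ᵢ ker Lᵢ)_ℂ`; there
proved by expanding in a `ℚ`-basis of `ℂ`), applied to the rational linear conditions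
`X ↦ ρ(X) t` resp. `b ↦ b X - X b` and transported along `κ`. That file treats the Lie algebra
of the Mumford–Tate stabiliser (weight `0`, type `(0,0)`); here the families of tensors and of
endomorphisms are arbitrary, as needed for the Hodge group (all types `(p,p)`). No definitions
and no named facts are introduced.

## References

* P. Deligne, *Hodge cycles on abelian varieties*, LNM 900 (1982), I §3 (invariants and flat
  base change: `(T ⊗ K)^{G_K} = T^G ⊗ K`).
* Yu. G. Zarhin, *Hodge groups of K3 surfaces*, J. reine angew. Math. 341 (1983), §2.
* N. Bourbaki, *Algèbre*, Ch. II §7 no. 8 (extension of scalars commutes with kernels and finite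
  intersections over a field).
-/

noncomputable section

open scoped TensorProduct

namespace Literature.AlgebraicGeometry.Motives

universe u v w

/-! ### Pushing complexified subspaces along `ℂ`-linear maps -/

section Generic

variable {M : Type u} [AddCommGroup M] [Module ℚ M]

/-- Elements of `p_ℂ` lie in the `ℂ`-span of the `1 ⊗ m`, `m ∈ p`, pushed along any `ℂ`-linear
map. [folklore] -/
theorem map_mem_span_of_mem_baseChange {P : Type v} [AddCommGroup P] [Module ℂ P]
    (κ : ℂ ⊗[ℚ] M →ₗ[ℂ] P) (p : Submodule ℚ M) {Y : ℂ ⊗[ℚ] M} (hY : Y ∈ p.baseChange ℂ) :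
    κ Y ∈ Submodule.span ℂ ((fun m : M => κ ((1 : ℂ) ⊗ₜ[ℚ] m)) '' (p : Set M)) := by
  rw [Submodule.baseChange_eq_span] at hY
  have h := Submodule.mem_map_of_mem (f := κ) hY
  rw [Submodule.map_span] at h
  refine Submodule.span_mono ?_ h
  rintro _ ⟨_, ⟨m, hm, rfl⟩, rfl⟩
  exact ⟨m, hm, rfl⟩

end Generic

/-! ### The comparison `ℂ ⊗ End_ℚ(V) ≅ End_ℂ(V_ℂ)` and the two descent statements -/

section Endomorphisms

variable {V : Type u} [AddCommGroup V] [Module ℚ V] [Module.Finite ℚ V]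

/-- Every `ℂ`-linear endomorphism of `V_ℂ` is `κ(Z₀)` for a unique `Z₀ ∈ ℂ ⊗ End_ℚ(V)`, where
`κ (c ⊗ X) = c • X_ℂ` (`homBaseChange`, bijective for finite-dimensional `V`). [folklore] -/
theorem exists_homBaseChange_eq (Y : Module.End ℂ (ℂ ⊗[ℚ] V)) :
    ∃ Z₀ : ℂ ⊗[ℚ] Module.End ℚ V, HodgeStructure.homBaseChange V V Z₀ = Y :=
  (HodgeStructure.homBaseChange_bijective (V := V) (W := V)).2 Y

/-- **Descent for commutants.** Let `𝔥 ⊆ End_ℚ(V)` be any family of rational endomorphisms of a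
finite-dimensional `V`. A `ℂ`-linear endomorphism `Y` of `V_ℂ` commuting with every `X_ℂ`,
`X ∈ 𝔥`, lies in the `ℂ`-span of the `b_ℂ` with `b ∈ End_ℚ(V)` commuting with every `X ∈ 𝔥`
("the commutant of a `ℚ`-group is defined over `ℚ`"; Deligne, LNM 900, I §3). [folklore] -/
theorem mem_span_baseChange_of_forall_commute (𝔥 : Set (Module.End ℚ V))
    {Y : Module.End ℂ (ℂ ⊗[ℚ] V)} (hY : ∀ X ∈ 𝔥, Y * X.baseChange ℂ = X.baseChange ℂ * Y) :
    Y ∈ Submodule.span ℂ ((fun b : Module.End ℚ V => b.baseChange ℂ) ''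
      {b | ∀ X ∈ 𝔥, b * X = X * b}) := by
  obtain ⟨Z₀, rfl⟩ := exists_homBaseChange_eq Y
  -- the rational linear conditions `b ↦ b X - X b`, `X ∈ 𝔥`
  let L : 𝔥 → Module.End ℚ V →ₗ[ℚ] Module.End ℚ V := fun X =>
    LinearMap.mulRight ℚ (X : Module.End ℚ V) - LinearMap.mulLeft ℚ (X : Module.End ℚ V)
  have hL : ∀ (X : 𝔥) (b : Module.End ℚ V), L X b = b * X - X * b := fun X b => rfl
  -- their complexifications are the conditions `Y X_ℂ - X_ℂ Y = 0` through `κ`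
  have hcomm : ∀ (X : 𝔥) (Z : ℂ ⊗[ℚ] Module.End ℚ V),
      HodgeStructure.homBaseChange V V ((L X).baseChange ℂ Z) =
        HodgeStructure.homBaseChange V V Z * (X : Module.End ℚ V).baseChange ℂ -
          (X : Module.End ℚ V).baseChange ℂ * HodgeStructure.homBaseChange V V Z := by
    intro X Z
    induction Z using TensorProduct.induction_on with
    | zero => simp
    | tmul c b =>
      rw [LinearMap.baseChange_tmul, HodgeStructure.homBaseChange_tmul,
        HodgeStructure.homBaseChange_tmul, hL, LinearMap.baseChange_sub,
        LinearMap.baseChange_mul, LinearMap.baseChange_mul, smul_sub, smul_mul_assoc,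
        mul_smul_comm]
    | add x y hx hy => rw [map_add, map_add, hx, hy, map_add]; noncomm_ring
  have hker : ∀ X : 𝔥, (L X).baseChange ℂ Z₀ = 0 := fun X => by
    apply (HodgeStructure.homBaseChange_bijective (V := V) (W := V)).1
    rw [hcomm, map_zero, sub_eq_zero, hY X X.2]
  have hmem := mem_baseChange_iInf_ker L hker
  have h := map_mem_span_of_mem_baseChange (HodgeStructure.homBaseChange V V) _ hmem
  refine Submodule.span_mono ?_ h
  rintro _ ⟨b, hb, rfl⟩
  refine ⟨b, fun X hX => ?_, ?_⟩
  swap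
  · show b.baseChange ℂ = HodgeStructure.homBaseChange V V ((1 : ℂ) ⊗ₜ[ℚ] b)
    rw [HodgeStructure.homBaseChange_tmul, one_smul]
  have := (Submodule.mem_iInf _).1 hb ⟨X, hX⟩
  rw [LinearMap.mem_ker, hL] at this
  exact sub_eq_zero.1 this

/-- The derivation action through `κ`: `ρ(κ Z) (ι t) = BC ((L_t)_ℂ Z)` where `L_t X = ρ(X) t`
is the rational condition and `BC = hodgeTensorSpaceBaseChange` the comparison isomorphism of
tensor spaces (naturality of the derivation action under extension of scalars). [folklore] -/
theorem tensorDerivation_homBaseChange_apply {a b : ℕ} (t : hodgeTensorSpace V a b)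
    (Z : ℂ ⊗[ℚ] Module.End ℚ V) :
    tensorDerivation a b (HodgeStructure.homBaseChange V V Z) (tensorSpaceToBaseChange ℂ V a b t) =
      hodgeTensorSpaceBaseChange V a b
        (((LinearMap.applyₗ t ∘ₗ tensorDerivation a b)).baseChange ℂ Z) := by
  induction Z using TensorProduct.induction_on with
  | zero => simp
  | tmul c X =>
    rw [HodgeStructure.homBaseChange_tmul, map_smul, LinearMap.smul_apply,
      LinearMap.baseChange_tmul, hodgeTensorSpaceBaseChange_tmul, LinearMap.comp_apply,
      LinearMap.applyₗ_apply_apply, ← hodgeTensorSpaceBaseChange_one_tmul,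
      ← hodgeTensorSpaceBaseChange_one_tmul, ← hodgeTensorSpaceBaseChange_tensorDerivation,
      LinearMap.baseChange_tmul]
  | add x y hx hy => rw [map_add, map_add, LinearMap.add_apply, hx, hy, map_add, map_add]

/-- **Descent for annihilators ("`Lie(Hdg)` is defined over `ℚ`").** Let `S a b ⊆ T^{a,b} V` be
any family of RATIONAL tensors (`V` finite-dimensional) and let `Y` be a `ℂ`-linear endomorphism of
`V_ℂ` whose derivation action kills the complexification `ι t` of every `t ∈ S a b`. Then `Y`
lies in the `ℂ`-span of the `X_ℂ`, `X ∈ End_ℚ(V)` with `ρ(X) t = 0` for all `t ∈ S a b` and all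
`a, b`: the complex annihilator is spanned by the rational annihilator (Deligne, LNM 900, I §3;
used by Zarhin 1983, §2, in the form "`Hdg` is a `ℚ`-group, so `Aut(ℂ)` acts on `Lie(Hdg)_ℂ`").
[folklore] -/
theorem mem_span_baseChange_of_forall_tensorDerivation_eq_zero
    (S : ∀ a b : ℕ, Set (hodgeTensorSpace V a b)) {Y : Module.End ℂ (ℂ ⊗[ℚ] V)}
    (hY : ∀ a b, ∀ t ∈ S a b, tensorDerivation a b Y (tensorSpaceToBaseChange ℂ V a b t) = 0) :
    Y ∈ Submodule.span ℂ ((fun X : Module.End ℚ V => X.baseChange ℂ) ''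
      {X | ∀ a b, ∀ t ∈ S a b, tensorDerivation a b X t = 0}) := by
  obtain ⟨Z₀, rfl⟩ := exists_homBaseChange_eq Y
  -- index the conditions by `i = ⟨a, b, t⟩`
  let I := Σ a b : ℕ, S a b
  let N : I → Type u := fun i => hodgeTensorSpace V i.1 i.2.1
  let L : ∀ i : I, Module.End ℚ V →ₗ[ℚ] N i := fun i =>
    LinearMap.applyₗ (i.2.2 : hodgeTensorSpace V i.1 i.2.1) ∘ₗ tensorDerivation i.1 i.2.1
  have hker : ∀ i : I, (L i).baseChange ℂ Z₀ = 0 := fun i => by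
    apply (hodgeTensorSpaceBaseChange V i.1 i.2.1).injective
    rw [map_zero, ← tensorDerivation_homBaseChange_apply]
    exact hY i.1 i.2.1 i.2.2 i.2.2.2
  have hmem := mem_baseChange_iInf_ker L hker
  have h := map_mem_span_of_mem_baseChange (HodgeStructure.homBaseChange V V) _ hmem
  refine Submodule.span_mono ?_ h
  rintro _ ⟨X, hX, rfl⟩
  refine ⟨X, fun a b t ht => ?_, ?_⟩
  swap
  · show X.baseChange ℂ = HodgeStructure.homBaseChange V V ((1 : ℂ) ⊗ₜ[ℚ] X)
    rw [HodgeStructure.homBaseChange_tmul, one_smul]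
  have := (Submodule.mem_iInf _).1 hX ⟨a, b, ⟨t, ht⟩⟩
  simpa [L] using this

end Endomorphisms

end Literature.AlgebraicGeometry.Motives

end
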